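import Literature.Analysis.Matrix.KyFanMaximumPrinciple

/-!
# The Eliashberg member of a `T_c` band: monotonicity under a scaling of the coupling

Companion to `EliashbergTcMonotonicity` (antitonicity in `μ*`) and `EliashbergIsotropicCompression`
(isotropic `≤` anisotropic). The conventional-branch screening pipelines (`pub/hubbard-eph`) multiply
the Eliashberg function of a material by a stated-assumption factor `f ∈ [f₋, f₊]` (spin–orbit or
density-of-states boxes on `λ`) and evaluate the linearised isotropic Migdal–Eliashberg `T_c` only at
the two corners `f₋` (lower band edge) and `f₊` (upper band edge). The corner rule needs `T_c` to be
monotone non-decreasing under `α²F ↦ f · α²F`; in print this is the positivity of the functional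
derivative `δT_c/δα²F(ω) > 0` [cite: BergmannRainer1973] (reviewed in
[cite: MarsiglioCarbotte2008, §4 «functional derivatives», p. 19 of arXiv:cond-mat/0106143]).
Here we prove the exact discretised statement the solvers rely on, by linear algebra only.

On `N` Matsubara frequencies `ω_n = πT(2n+1)` the linearised imaginary-axis equations
[cite: MarsiglioCarbotte2008, Eqs. (gb1), (gb3) with `A₀ ≡ 1`, `A₁ ≡ 0`, p. 11] read
`ω_n Z_n = ω_n + πT Σ_m λ(n−m) sgn ω_m` and `φ_n = πT Σ_m (λ(n−m) − μ*) φ_m / (|ω_m| Z_m)`; with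
`ψ_n = φ_n / (ω_n Z_n)^{1/2}` this is the eigenproblem of the real symmetric matrix
`K_{nm} = πT (λ_{nm} − μ) / ((ω_n Z_n)(ω_m Z_m))^{1/2}`, and `T < T_c` iff its top eigenvalue is `≥ 1`
[cite: AllenDynes1975, Eqs. (9)–(12)]. Under `α²F ↦ f α²F` every `λ(k)` becomes `f λ(k)`, so
`K(f)_{nm} = (f Λ_{nm} − μ) / ((c_n + f a_n)(c_m + f a_m))^{1/2}` with `Λ` the phonon matrix
(Toeplitz, or Toeplitz-plus-Hankel in the even sector), `c_n = 2n+1 > 0`, `a_n = Σ_m λ_{nm} sgn ω_m ≥ 0`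
and `μ ≥ 0` the (cutoff) pseudopotential (times `2` in the folded even sector).

Proved here:
* `eigenvalues₀_max_le_of_nonneg_of_le` — Perron-type comparison: for real symmetric `0 ≤ A ≤ B`
  (entrywise) the top eigenvalues satisfy `λ_max(A) ≤ λ_max(B)` [cite: HornJohnson2013, Cor. 8.1.19
  (monotonicity of the spectral radius on nonnegative matrices), with Thm. 4.2.2 (Rayleigh)];
* `couplingScaledKernel`, `isHermitian_couplingScaledKernel` — the family `K(f)` above;
* `dotProduct_couplingScaledKernel_mulVec` (and the private `dotProduct_self_sqrtWeight`) — the substitution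
  `x_n = (c_n + f a_n)^{1/2} y_n` turns the Rayleigh quotient of `K(f)` into
  `(f · yᵀΛy − μ (Σ y)²) / (Σ (c_n + f a_n) y_n²)`, a ratio `(α f − β)/(γ + δ f)` with
  `α, β, γ, δ ≥ 0` when `Λ ⪰ 0` — hence non-decreasing in `f`;
* `eigenvalues₀_max_couplingScaledKernel_mono` — **the top eigenvalue of `K(f)` is monotone
  non-decreasing in `f > 0`** for `Λ` positive semidefinite, `c > 0`, `a ≥ 0`, `μ ≥ 0`;
* `sSup_superlevel_couplingScaled_mono` — threshold form: the linearised-Eliashberg `T_c`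
  (`sup {T > 0 | 1 ≤ ρ(T, f)}`) is monotone non-decreasing in `f` (the f-box corner rule).

The hypothesis `Λ ⪰ 0` holds for every Eliashberg phonon matrix: `λ(n−m) = ∫ α²F(ω) 2ω/(ω² +
(2πT)²(n−m)²) dω` is a positive-definite Toeplitz sequence because `ν ↦ 2ω/(ω²+ν²)` is the Fourier
transform of the positive function `e^{−ω|t|}` (Bochner), and the even-sector Toeplitz-plus-Hankel
matrix is the compression of the full-line Toeplitz matrix to even sequences; this classical fact is
NOT formalised here (it is taken as the hypothesis `hΛ`, which the engines can also check numerically).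
Deliberately NOT here: frequency scaling `α²F(ω) ↦ α²F(ω/g)` (an exact similarity `T_c ↦ g T_c`),
the nonlinear equations, anisotropic kernels.

## References
* [BergmannRainer1973] G. Bergmann, D. Rainer, Z. Phys. 263 (1973) 59–68 — `δT_c/δα²F(ω) ≥ 0`.
* [MarsiglioCarbotte2008] F. Marsiglio, J. P. Carbotte, *Electron–Phonon Superconductivity*, in
  Bennemann–Ketterson (eds.), Superconductivity, Springer 2008, pp. 73–162 (= arXiv:cond-mat/0106143)
  — imaginary-axis equations (gb1)–(gb4) p. 11; functional derivatives §4 p. 19.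
* [AllenDynes1975] P. B. Allen, R. C. Dynes, Phys. Rev. B 12 (1975) 905 — Eqs. (9)–(12).
* [HornJohnson2013] R. A. Horn, C. R. Johnson, *Matrix Analysis*, 2nd ed., CUP 2013 — Thm. 4.2.2,
  Cor. 8.1.19.
-/

noncomputable section

open scoped Matrix

namespace Literature.MathematicalPhysics.QuantumManyBody

open Finset _root_.Matrix Literature.Analysis.Matrix

variable {ι : Type*} [Fintype ι] [DecidableEq ι]

/-! ### Top eigenvalue: attainment and the Perron-type comparison -/

/-- **Attainment of the top eigenvalue**: a real symmetric matrix on a nonempty index type has a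
unit vector `h` with `hᵀ W h = λ_max(W)` (the case `k = 1` of Ky Fan's principle).
[cite: HornJohnson2013, Thm. 4.2.2 (Rayleigh)] -/
theorem exists_unit_dotProduct_mulVec_eq_eigenvalues₀_max {W : Matrix ι ι ℝ} (hW : W.IsHermitian)
    (hn : 1 ≤ Fintype.card ι) :
    ∃ h : ι → ℝ, h ⬝ᵥ h = 1 ∧ h ⬝ᵥ W *ᵥ h = hW.eigenvalues₀ (Fin.castLE hn 0) := by
  obtain ⟨h, horth, -, hsum⟩ := KyFan.exists_frame_sum_rayleigh_eq hW (k := 1) hn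
  refine ⟨h 0, ?_, ?_⟩
  · simpa using horth 0 0
  · simpa using hsum

/-- **Perron-type comparison of top eigenvalues.** For real symmetric matrices with
`0 ≤ A i j ≤ B i j` for all `i, j`, the largest eigenvalues satisfy `λ_max(A) ≤ λ_max(B)`:
take a unit top eigenvector `h` of `A`; then `λ_max(A) = Σ A_ij h_i h_j ≤ Σ B_ij |h_i| |h_j| ≤ λ_max(B)`.
(For nonnegative symmetric matrices `λ_max` is the spectral radius, so this is the monotonicity of
the Perron root.) [cite: HornJohnson2013, Cor. 8.1.19 with Thm. 4.2.2] -/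
theorem eigenvalues₀_max_le_of_nonneg_of_le {A B : Matrix ι ι ℝ} (hA : A.IsHermitian)
    (hB : B.IsHermitian) (h0 : ∀ i j, 0 ≤ A i j) (hle : ∀ i j, A i j ≤ B i j)
    (hn : 1 ≤ Fintype.card ι) :
    hA.eigenvalues₀ (Fin.castLE hn 0) ≤ hB.eigenvalues₀ (Fin.castLE hn 0) := by
  obtain ⟨h, hunit, hval⟩ := exists_unit_dotProduct_mulVec_eq_eigenvalues₀_max hA hn
  set v : ι → ℝ := fun i => |h i| with hv
  have hvv : v ⬝ᵥ v = 1 := by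
    rw [← hunit]
    simp only [dotProduct, hv]
    exact Finset.sum_congr rfl fun i _ => by rw [← abs_mul, abs_mul_self]
  have h1 : h ⬝ᵥ A *ᵥ h ≤ v ⬝ᵥ B *ᵥ v := by
    simp only [dotProduct, mulVec, hv, Finset.mul_sum]
    refine Finset.sum_le_sum fun i _ => Finset.sum_le_sum fun j _ => ?_
    calc h i * (A i j * h j) = A i j * (h i * h j) := by ring
      _ ≤ A i j * |h i * h j| := mul_le_mul_of_nonneg_left (le_abs_self _) (h0 i j)
      _ = A i j * (|h i| * |h j|) := by rw [abs_mul]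
      _ ≤ B i j * (|h i| * |h j|) :=
          mul_le_mul_of_nonneg_right (hle i j) (mul_nonneg (abs_nonneg _) (abs_nonneg _))
      _ = |h i| * (B i j * |h j|) := by ring
  have h2 := KyFan.dotProduct_mulVec_le_eigenvalues₀_max_mul hB hn v
  rw [hvv, mul_one] at h2
  rw [← hval]
  exact h1.trans h2

/-! ### The coupling-scaled kernel family -/

/-- **The symmetrised linearised Eliashberg kernel as a function of the coupling scale `f`.**
`couplingScaledKernel Λ c a μ f = ((f Λ_{nm} − μ) / ((c_n + f a_n)^{1/2} (c_m + f a_m)^{1/2}))_{nm}`: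
`Λ` the phonon matrix (`λ(n−m)`, or `λ(n−m) + λ(n+m+1)` in the even sector), `c_n = 2n+1` the bare
Matsubara weights, `a_n = Σ_m λ_{nm} sgn ω_m` the mass-renormalisation sums (so that
`ω_n Z_n / (πT) = c_n + f a_n` under `α²F ↦ f α²F`), `μ` the cutoff pseudopotential (`2μ*_N` in the
even sector). Stated for arbitrary real data. [cite: MarsiglioCarbotte2008, Eqs. (gb1), (gb3) p. 11] -/
def couplingScaledKernel (Λ : Matrix ι ι ℝ) (c a : ι → ℝ) (μ f : ℝ) : Matrix ι ι ℝ :=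
  Matrix.of fun n m => (f * Λ n m - μ) / (Real.sqrt (c n + f * a n) * Real.sqrt (c m + f * a m))

omit [Fintype ι] [DecidableEq ι] in
/-- The coupling-scaled kernel is real symmetric when the phonon matrix is.
[cite: MarsiglioCarbotte2008, Eqs. (gb1), (gb3) p. 11] -/
theorem isHermitian_couplingScaledKernel {Λ : Matrix ι ι ℝ} (hΛ : Λ.IsHermitian) (c a : ι → ℝ)
    (μ f : ℝ) : (couplingScaledKernel Λ c a μ f).IsHermitian := by
  refine Matrix.IsHermitian.ext fun i j => ?_
  have hij : Λ j i = Λ i j := by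
    simpa using congrFun (congrFun hΛ i) j
  simp only [couplingScaledKernel, Matrix.of_apply, star_trivial, hij, mul_comm]

omit [Fintype ι] [DecidableEq ι] in
/-- The positive weights `p_n(f) = c_n + f a_n` (`= ω_n Z_n / (πT)`). [folklore] -/
private theorem weight_pos {c a : ι → ℝ} (hc : ∀ n, 0 < c n) (ha : ∀ n, 0 ≤ a n) {f : ℝ}
    (hf : 0 ≤ f) (n : ι) : 0 < c n + f * a n :=
  add_pos_of_pos_of_nonneg (hc n) (mul_nonneg hf (ha n))

omit [DecidableEq ι] in
/-- **The substitution `x = p(f)^{1/2} y`.** For `x_n = (c_n + f a_n)^{1/2} y_n`: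
`xᵀ K(f) x = f · yᵀ Λ y − μ (Σ_n y_n)²`. [cite: MarsiglioCarbotte2008, Eqs. (gb1), (gb3) p. 11] -/
theorem dotProduct_couplingScaledKernel_mulVec (Λ : Matrix ι ι ℝ) {c a : ι → ℝ}
    (hc : ∀ n, 0 < c n) (ha : ∀ n, 0 ≤ a n) (μ : ℝ) {f : ℝ} (hf : 0 ≤ f) (y : ι → ℝ) :
    (fun n => Real.sqrt (c n + f * a n) * y n) ⬝ᵥ couplingScaledKernel Λ c a μ f *ᵥ
        (fun n => Real.sqrt (c n + f * a n) * y n) =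
      f * (y ⬝ᵥ Λ *ᵥ y) - μ * (∑ n, y n) ^ 2 := by
  have hs : ∀ n, Real.sqrt (c n + f * a n) ≠ 0 := fun n =>
    (Real.sqrt_pos.mpr (weight_pos hc ha hf n)).ne'
  simp only [dotProduct, mulVec, couplingScaledKernel, Matrix.of_apply, Finset.mul_sum, sq,
    Finset.sum_mul, Finset.mul_sum, ← Finset.sum_sub_distrib]
  refine Finset.sum_congr rfl fun n _ => Finset.sum_congr rfl fun m _ => ?_
  have hn' := hs n
  have hm' := hs m
  rw [div_mul_eq_mul_div, mul_div_assoc', div_eq_iff (mul_ne_zero hn' hm')]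
  ring

omit [DecidableEq ι] in
/-- For `x_n = (c_n + f a_n)^{1/2} y_n`: `xᵀ x = Σ_n (c_n + f a_n) y_n²`. [folklore] -/
private theorem dotProduct_self_sqrtWeight {c a : ι → ℝ} (hc : ∀ n, 0 < c n) (ha : ∀ n, 0 ≤ a n)
    {f : ℝ} (hf : 0 ≤ f) (y : ι → ℝ) :
    (fun n => Real.sqrt (c n + f * a n) * y n) ⬝ᵥ (fun n => Real.sqrt (c n + f * a n) * y n) =
      ∑ n, (c n + f * a n) * y n ^ 2 := by
  simp only [dotProduct]
  refine Finset.sum_congr rfl fun n _ => ?_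
  have h := Real.mul_self_sqrt (weight_pos hc ha hf n).le
  calc Real.sqrt (c n + f * a n) * y n * (Real.sqrt (c n + f * a n) * y n)
        = (Real.sqrt (c n + f * a n) * Real.sqrt (c n + f * a n)) * (y n * y n) := by ring
    _ = (c n + f * a n) * y n ^ 2 := by rw [h, sq]

/-- The elementary inequality behind the monotonicity: for `α, β, γ, δ ≥ 0` and `f₁ ≤ f₂`,
`(α f₁ − β)(γ + δ f₂) ≤ (α f₂ − β)(γ + δ f₁)` (i.e. `f ↦ (αf − β)/(γ + δf)` is non-decreasing).
[folklore] -/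
private theorem sub_mul_add_le_sub_mul_add {α β γ δ f₁ f₂ : ℝ} (hα : 0 ≤ α) (hβ : 0 ≤ β)
    (hγ : 0 ≤ γ) (hδ : 0 ≤ δ) (hf : f₁ ≤ f₂) :
    (α * f₁ - β) * (γ + δ * f₂) ≤ (α * f₂ - β) * (γ + δ * f₁) := by
  have : 0 ≤ (f₂ - f₁) * (α * γ + β * δ) :=
    mul_nonneg (by linarith) (add_nonneg (mul_nonneg hα hγ) (mul_nonneg hβ hδ))
  nlinarith

/-- **The top linearised-Eliashberg eigenvalue is monotone non-decreasing in the coupling scale.**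
For a positive semidefinite symmetric phonon matrix `Λ`, bare weights `c > 0`, renormalisation sums
`a ≥ 0` and pseudopotential `μ ≥ 0`: `0 < f₁ ≤ f₂ ⟹ λ_max(K(f₁)) ≤ λ_max(K(f₂))`. Proof: with the top
unit eigenvector `x₁` of `K(f₁)` and `y = x₁ / p(f₁)^{1/2}`, `λ_max(K(f₁)) = (αf₁ − β)/(γ + δf₁)` with
`α = yᵀΛy ≥ 0`, `β = μ(Σy)² ≥ 0`, `γ = Σ c y² ≥ 0`, `δ = Σ a y² ≥ 0`; the vector `p(f₂)^{1/2} y` has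
Rayleigh quotient `(αf₂ − β)/(γ + δf₂) ≥` that, and is bounded by `λ_max(K(f₂))`. This is the
discretised form of `δT_c/δα²F ≥ 0` restricted to the direction `α²F` itself.
[cite: BergmannRainer1973] [cite: MarsiglioCarbotte2008, §4 p. 19] -/
theorem eigenvalues₀_max_couplingScaledKernel_mono {Λ : Matrix ι ι ℝ} (hΛ : Λ.IsHermitian)
    (hpsd : ∀ y : ι → ℝ, 0 ≤ y ⬝ᵥ Λ *ᵥ y) {c a : ι → ℝ} (hc : ∀ n, 0 < c n) (ha : ∀ n, 0 ≤ a n)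
    {μ : ℝ} (hμ : 0 ≤ μ) {f₁ f₂ : ℝ} (hf₁ : 0 < f₁) (hf : f₁ ≤ f₂) (hn : 1 ≤ Fintype.card ι) :
    (isHermitian_couplingScaledKernel hΛ c a μ f₁).eigenvalues₀ (Fin.castLE hn 0) ≤
      (isHermitian_couplingScaledKernel hΛ c a μ f₂).eigenvalues₀ (Fin.castLE hn 0) := by
  have hf₂ : 0 ≤ f₂ := hf₁.le.trans hf
  obtain ⟨x, hxx, hval⟩ :=
    exists_unit_dotProduct_mulVec_eq_eigenvalues₀_max (isHermitian_couplingScaledKernel hΛ c a μ f₁) hn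
  -- the substituted vector y = x / √p(f₁) and its two lifts
  set y : ι → ℝ := fun n => x n / Real.sqrt (c n + f₁ * a n) with hy
  have hx : (fun n => Real.sqrt (c n + f₁ * a n) * y n) = x := by
    funext n
    have hs : Real.sqrt (c n + f₁ * a n) ≠ 0 :=
      (Real.sqrt_pos.mpr (weight_pos hc ha hf₁.le n)).ne'
    simp only [hy]
    field_simp
  set α : ℝ := y ⬝ᵥ Λ *ᵥ y with hα
  set β : ℝ := μ * (∑ n, y n) ^ 2 with hβ
  set γ : ℝ := ∑ n, c n * y n ^ 2 with hγ
  set δ : ℝ := ∑ n, a n * y n ^ 2 with hδ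
  have hα0 : 0 ≤ α := hpsd y
  have hβ0 : 0 ≤ β := mul_nonneg hμ (sq_nonneg _)
  have hγ0 : 0 ≤ γ := Finset.sum_nonneg fun n _ => mul_nonneg (hc n).le (sq_nonneg _)
  have hδ0 : 0 ≤ δ := Finset.sum_nonneg fun n _ => mul_nonneg (ha n) (sq_nonneg _)
  have hsplit : ∀ f : ℝ, ∑ n, (c n + f * a n) * y n ^ 2 = γ + δ * f := fun f => by
    simp only [hγ, hδ, add_mul, Finset.sum_add_distrib, Finset.sum_mul]
    refine congrArg₂ (· + ·) rfl (Finset.sum_congr rfl fun n _ => by ring)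
  -- at f₁: numerator = λ₁, denominator = 1
  have hnum₁ : x ⬝ᵥ couplingScaledKernel Λ c a μ f₁ *ᵥ x = α * f₁ - β := by
    rw [← hx, dotProduct_couplingScaledKernel_mulVec Λ hc ha μ hf₁.le y, hα, hβ, mul_comm]
  have hden₁ : γ + δ * f₁ = 1 := by
    rw [← hsplit, ← dotProduct_self_sqrtWeight hc ha hf₁.le y, hx, hxx]
  -- at f₂: Rayleigh bound for the lifted vector
  set x₂ : ι → ℝ := fun n => Real.sqrt (c n + f₂ * a n) * y n with hx₂
  have hnum₂ : x₂ ⬝ᵥ couplingScaledKernel Λ c a μ f₂ *ᵥ x₂ = α * f₂ - β := by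
    rw [hx₂, dotProduct_couplingScaledKernel_mulVec Λ hc ha μ hf₂ y, hα, hβ, mul_comm]
  have hden₂ : x₂ ⬝ᵥ x₂ = γ + δ * f₂ := by
    rw [hx₂, dotProduct_self_sqrtWeight hc ha hf₂ y, hsplit]
  have hR := KyFan.dotProduct_mulVec_le_eigenvalues₀_max_mul
    (isHermitian_couplingScaledKernel hΛ c a μ f₂) hn x₂
  rw [hnum₂, hden₂] at hR
  -- combine
  set L₁ := (isHermitian_couplingScaledKernel hΛ c a μ f₁).eigenvalues₀ (Fin.castLE hn 0)
  set L₂ := (isHermitian_couplingScaledKernel hΛ c a μ f₂).eigenvalues₀ (Fin.castLE hn 0)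
  have hL₁ : L₁ = α * f₁ - β := by rw [← hval, hnum₁]
  have hkey : (α * f₁ - β) * (γ + δ * f₂) ≤ (α * f₂ - β) * (γ + δ * f₁) :=
    sub_mul_add_le_sub_mul_add hα0 hβ0 hγ0 hδ0 hf
  rw [hden₁, mul_one] at hkey
  have hpos : 0 < γ + δ * f₂ := by
    have : γ + δ * f₁ ≤ γ + δ * f₂ := by nlinarith
    linarith
  -- L₁ (γ + δ f₂) ≤ α f₂ − β ≤ L₂ (γ + δ f₂)
  have : L₁ * (γ + δ * f₂) ≤ L₂ * (γ + δ * f₂) := by rw [hL₁]; exact hkey.trans hR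
  exact le_of_mul_le_mul_right this hpos

/-! ### Threshold form: the `f`-box corner rule for `T_c` -/

/-- **`T_c` of the linearised isotropic Eliashberg equations is monotone non-decreasing under
`α²F ↦ f α²F`.** With temperature-dependent data `Λ(T) ⪰ 0`, `a(T) ≥ 0` (and `c > 0`, `μ ≥ 0` fixed)
let `ρ(T, f) = λ_max(K_T(f))`; then for `0 < f₁ ≤ f₂` the super-level set `{T > 0 | 1 ≤ ρ(T, f₁)}`
is contained in that of `f₂`, so `T_c(f₁) = sup ≤ T_c(f₂)` whenever the latter set is bounded
above (`sSup ∅ = 0` covers «no superconductivity at `f₁`»). This is the corner rule used for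
multiplicative `λ`-boxes: the lower band edge at `f₋`, the upper at `f₊`.
[cite: BergmannRainer1973] [cite: AllenDynes1975, Eqs. (9)–(12)] -/
theorem sSup_superlevel_couplingScaled_mono {Λ : ℝ → Matrix ι ι ℝ} (hΛ : ∀ T, (Λ T).IsHermitian)
    (hpsd : ∀ T (y : ι → ℝ), 0 ≤ y ⬝ᵥ Λ T *ᵥ y) {c : ι → ℝ} (hc : ∀ n, 0 < c n) {a : ℝ → ι → ℝ}
    (ha : ∀ T n, 0 ≤ a T n) {μ : ℝ} (hμ : 0 ≤ μ) {f₁ f₂ : ℝ} (hf₁ : 0 < f₁) (hf : f₁ ≤ f₂)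
    (hn : 1 ≤ Fintype.card ι)
    (hbdd : BddAbove {T : ℝ | 0 < T ∧
      1 ≤ (isHermitian_couplingScaledKernel (hΛ T) c (a T) μ f₂).eigenvalues₀ (Fin.castLE hn 0)}) :
    sSup {T : ℝ | 0 < T ∧
        1 ≤ (isHermitian_couplingScaledKernel (hΛ T) c (a T) μ f₁).eigenvalues₀ (Fin.castLE hn 0)} ≤
      sSup {T : ℝ | 0 < T ∧
        1 ≤ (isHermitian_couplingScaledKernel (hΛ T) c (a T) μ f₂).eigenvalues₀ (Fin.castLE hn 0)} := by
  have hsub : {T : ℝ | 0 < T ∧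
        1 ≤ (isHermitian_couplingScaledKernel (hΛ T) c (a T) μ f₁).eigenvalues₀ (Fin.castLE hn 0)} ⊆
      {T : ℝ | 0 < T ∧
        1 ≤ (isHermitian_couplingScaledKernel (hΛ T) c (a T) μ f₂).eigenvalues₀ (Fin.castLE hn 0)} :=
    fun T ⟨hT, h1⟩ => ⟨hT, h1.trans
      (eigenvalues₀_max_couplingScaledKernel_mono (hΛ T) (hpsd T) hc (ha T) hμ hf₁ hf hn)⟩
  by_cases hne : ({T : ℝ | 0 < T ∧
      1 ≤ (isHermitian_couplingScaledKernel (hΛ T) c (a T) μ f₁).eigenvalues₀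
        (Fin.castLE hn 0)} : Set ℝ).Nonempty
  · exact csSup_le_csSup hbdd hne hsub
  · rw [Set.not_nonempty_iff_eq_empty] at hne
    rw [hne, Real.sSup_empty]
    exact Real.sSup_nonneg fun T hT => hT.1.le

end Literature.MathematicalPhysics.QuantumManyBody

end
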